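import Literature.NumberTheory.EllipticCurves.SUnitMordellCurveConstructions
import Literature.NumberTheory.EllipticCurves.FreyHellegouarchNormalizedCurveProofs
import Literature.NumberTheory.EllipticCurves.FreyHellegouarchTwoIsogenousCurveProofs
import HarnessLib

/-!
# von Känel–Matschke, Lemma 10.5 with (eq:refinedcondbound) — PROVED
# (`vonKanelMatschke_lemma_10_5_holds`)

Topic `Literature/NumberTheory/EllipticCurves` (family `abc`, LADDER-ABC A1: the *modular method*).
A proofs-only companion (theorems only; NO definition, NO new named fact, nothing restated; D-0026)
of `SUnitMordellCurveConstructions.lean`: the named fact `vonKanelMatschke_lemma_10_5` —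
R. von Känel, B. Matschke, arXiv:1605.06079 = Mem. AMS **286** (2023) no. 1419
[`VonkanelMatschke2023`], **Lemma 10.5** (`lem:psu2`): *"Suppose that `(a, b, c)` is a solution of
(eq:abc). Then there exist `ℚ`-isogenous elliptic curves `E` and `E'` over `ℚ` such that `N_E`
divides `2⁴N_S`, `Δ_E = 2ⁿ(abc)²` with `n ∈ {4, −8}`, and `Δ_{E'} = 2^{8−12m}|ab|c⁴` with
`m ∈ {0, 1, 2, 3}`"* together with the remark (eq:refinedcondbound) *"`ord₂(N_E) = 𝔢 + 1`"* — is
DISCHARGED: `vonKanelMatschke_lemma_10_5_holds`. With it the `S`-unit side of the vKM §10 deduction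
DAG in the tree (Prop. 10.6, Prop. 10.2, (eq:asymptoticsu), Murty–Pasten Thms 1.1/1.2, von Känel
2014 Cor. 7.2, the `abc` half of Prop. 10.7; files `AbcHeightBoundFreyHellegouarchProofs`,
`VonKanelMatschkeRootReductionSummary`) hangs off {modularity, Prop. 10.8 (i), the Ogg–Saito
schema} only.

## The printed proof (arXiv §10.4, pp. 59–60) and its formalisation

1. *Normalisation*: "exactly one of the numbers `a, b, c` is even … `B'` … `A'` … `(A, B, C) =
   ±(A', B', A'+B')` with `A ≡ −1 (mod 4)`, `B` even; `E : y² = x(x − A)(x + B)`" — the case analysis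
   of `vonKanelMatschke_lemma_10_5_holds` below (`a`, `b` or `c` even; a sign `±`), with
   `E = freyCurve A B` (`EllipticCurves/Szpiro`).
2. *`N_E ∣ 2⁴ rad(abc) ∣ 2⁴N_S`, `ord₂(N_E) = 𝔢 + 1`, `Δ_E = 2⁴(abc)²` or `2⁻⁸(abc)²`* (Diamond–Kramer,
   Silverman): `FreyHellegouarchNormalizedCurveProofs` (`conductorNorm_freyCurve_dvd_two_pow_four_mul_radical`,
   `factorization_two_conductorNorm_freyCurve_normalised`, `minimalDiscriminantNorm_freyCurve_normalised`),
   the table `refinedExp` being matched in `refinedExp_add_one_eq_table`.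
3. *`E'`*: "`E` admits the Weierstrass equation `y² = x'(x' − α)(x' + β)`" with `α + β = ±c` (a
   translate `translate_freyCurve` when `c` is the even one) "… is `ℚ`-isogenous to
   `E' : w² = z³ − 2(β − α)z² + γ²z` … `Δ_{E'} = 2^{8−12m}|ab|c⁴` with `m ∈ {0, 1, 2, 3}`":
   `FreyHellegouarchTwoIsogenousCurveProofs` (`isIsogenous_freyCurve_twoIsogenyCodomain` = Silverman's
   explicit `2`-isogeny of the tree, `exists_two_pow_mul_minimalDiscriminantNorm_twoIsogenyCodomain_freyCurve`).

No `abc` claim; typed ≠ endorsed. All theorems; axioms standard.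

## References

* R. von Känel, B. Matschke, arXiv:1605.06079 (2016) = Mem. AMS 286 (2023), Lemma 10.5
  (`lem:psu2`), its proof, and (eq:refinedcondbound), §10.4. [VonkanelMatschke2023]
* F. Diamond, K. Kramer, Math. Res. Lett. 2 (1995) 299–304. [DiamondKramer1995]
* J. H. Silverman, *The Arithmetic of Elliptic Curves*, 2nd ed., III.4.5, VII.1, VIII.8. [SilvermanAEC2009]
-/

noncomputable section

open IsDedekindDomain WeierstrassCurve UniqueFactorizationMonoid
open Literature.NumberTheory.DiophantineGeometry
open Literature.NumberTheory.DiophantineGeometry.VonKanelMatschke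

namespace Literature.NumberTheory.EllipticCurves.ModularForms

/-! ### 1. Arithmetic preliminaries -/

section Prelim

variable {a b c : ℤ}

/-- `gcd(a, b, c) = 1` and `a + b = c` give `gcd(a, b) = 1` (vKM §10.4: "`a, b, c` … are coprime").
[cite: VonkanelMatschke2023, Lemma 10.5 (proof, arXiv §10.4 p. 59)] -/
theorem isCoprime_of_gcd_gcd_eq_one (habc : a + b = c) (h : Int.gcd (Int.gcd a b : ℤ) c = 1) :
    IsCoprime a b := by
  rw [Int.isCoprime_iff_gcd_eq_one]
  set d := Int.gcd a b with hd
  have hda : (d : ℤ) ∣ a := Int.gcd_dvd_left ..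
  have hdb : (d : ℤ) ∣ b := Int.gcd_dvd_right ..
  have hdc : (d : ℤ) ∣ c := habc ▸ dvd_add hda hdb
  have h1 : d ∣ Int.gcd (d : ℤ) c := Int.dvd_gcd (dvd_refl _) hdc
  rw [h] at h1
  exact Nat.dvd_one.mp h1

/-- For `A` odd and `B` even, `ord₂(AB(A+B)) = ord₂(B)`. [folklore] -/
private theorem padicValNat_natAbs_prod_eq {A B : ℤ} (h0 : A * B * (A + B) ≠ 0) (hA : ¬ (2 : ℤ) ∣ A)
    (hB : (2 : ℤ) ∣ B) :
    padicValNat 2 (A * B * (A + B)).natAbs = padicValNat 2 B.natAbs := by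
  haveI : Fact (Nat.Prime 2) := ⟨Nat.prime_two⟩
  have hA0 : A ≠ 0 := fun h ↦ h0 (by rw [h]; ring)
  have hB0 : B ≠ 0 := fun h ↦ h0 (by rw [h]; ring)
  have hC0 : A + B ≠ 0 := fun h ↦ h0 (by rw [h]; ring)
  have hC : ¬ (2 : ℤ) ∣ A + B := fun h ↦ hA (by simpa using dvd_sub h hB)
  have hA' : padicValInt 2 A = 0 := padicValInt.eq_zero_of_not_dvd (by exact_mod_cast hA)
  have hC' : padicValInt 2 (A + B) = 0 := padicValInt.eq_zero_of_not_dvd (by exact_mod_cast hC)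
  change padicValInt 2 (A * B * (A + B)) = padicValInt 2 B
  rw [padicValInt.mul (mul_ne_zero hA0 hB0) hC0, padicValInt.mul hA0 hB0, hA', hC']
  ring

/-- An even non-zero integer has `ord₂ ≥ 1`. [folklore] -/
private theorem one_le_padicValNat_of_two_dvd {B : ℤ} (hB0 : B ≠ 0) (hB : (2 : ℤ) ∣ B) :
    1 ≤ padicValNat 2 B.natAbs := by
  haveI : Fact (Nat.Prime 2) := ⟨Nat.prime_two⟩
  have h := (padicValInt_dvd_iff (p := 2) 1 B).mp (by simpa using hB)
  exact h.resolve_left hB0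

/-- **The table (eq:refinedcondbound) against Diamond–Kramer's exponents**: for `v ≥ 1`,
`𝔢(v) + 1 = 5, 3, 3, 0, 1` according as `v = 1, 2, 3, 4, ≥ 5`.
[cite: VonkanelMatschke2023, §10.4 (eq:refinedcondbound)] -/
theorem refinedExp_add_one_eq_table {v : ℕ} (hv : 1 ≤ v) :
    refinedExp v + 1 =
      ((if v = 1 then 5 else if v ≤ 3 then 3 else if v = 4 then 0 else 1 : ℕ) : ℤ) := by
  unfold refinedExp
  split_ifs <;> omega

end Prelim

/-! ### 2. The lemma for a normalised presentation -/

section Presentation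

variable {α β A B : ℤ} {S : Finset ℕ}

/-- **Lemma 10.5 for a normalised presentation.** Let `α, β` be coprime with `αβ(α+β) ≠ 0`, and
let `E = E_{A,B}` be a normalised presentation (`A, B` coprime, `A ≡ −1 (mod 4)`, `B` even) of a
curve `ℚ`-isogenous to `E' = (E_{α,β})'` with `|AB(A+B)| = |αβ(α+β)|`; suppose `rad(αβ(α+β)) ∣ N_S`.
Then `E, E'` have all the properties of vKM Lemma 10.5 + (eq:refinedcondbound), with
`(abc)² = (αβ(α+β))²`, `|ab| = |αβ|`, `c⁴ = (α+β)⁴`. [cite: VonkanelMatschke2023, Lemma 10.5 (arXiv §10.4, lem:psu2) with (eq:refinedcondbound)] -/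
theorem lemma_10_5_of_presentation (hαβ : IsCoprime α β) (h0 : α * β * (α + β) ≠ 0)
    (hAB : IsCoprime A B) (h0' : A * B * (A + B) ≠ 0) (hA : A ≡ -1 [ZMOD 4]) (hB : (2 : ℤ) ∣ B)
    (habs : (A * B * (A + B)).natAbs = (α * β * (α + β)).natAbs)
    (hiso : (freyCurve A B).IsIsogenous (freyCurve α β).twoIsogenyCodomain)
    (hrad : radical (α * β * (α + β)).natAbs ∣ primesProd S) :
    ∃ (W W' : WeierstrassCurve ℚ) (_ : W.IsElliptic) (_ : W'.IsElliptic),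
      W.IsIsogenous W' ∧
      W.conductorNorm ℤ ∣ 2 ^ 4 * primesProd S ∧
      (padicValNat 2 (W.conductorNorm ℤ) : ℤ) =
          refinedExp (padicValNat 2 (α * β * (α + β)).natAbs) + 1 ∧
      (W.minimalDiscriminantNorm ℤ = 2 ^ 4 * (α * β * (α + β)).natAbs ^ 2 ∨
        2 ^ 8 * W.minimalDiscriminantNorm ℤ = (α * β * (α + β)).natAbs ^ 2) ∧
      ∃ m : ℕ, m ≤ 3 ∧ 2 ^ (12 * m) * W'.minimalDiscriminantNorm ℤ =
        2 ^ 8 * (α * β).natAbs * (α + β).natAbs ^ 4 := by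
  haveI hE := isElliptic_freyCurve h0'
  haveI hE' := isElliptic_twoIsogenyCodomain_freyCurve h0
  refine ⟨freyCurve A B, (freyCurve α β).twoIsogenyCodomain, hE, hE', hiso, ?_, ?_, ?_,
    exists_two_pow_mul_minimalDiscriminantNorm_twoIsogenyCodomain_freyCurve hαβ h0⟩
  · -- `N_E ∣ 2⁴ rad(abc) ∣ 2⁴ N_S`
    have h := conductorNorm_freyCurve_dvd_two_pow_four_mul_radical hAB h0' hA hB
    rw [habs] at h
    exact h.trans (mul_dvd_mul_left _ hrad)
  · -- `ord₂(N_E) = 𝔢 + 1`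
    have hB0 : B ≠ 0 := fun h ↦ h0' (by rw [h]; ring)
    have hA2 : ¬ (2 : ℤ) ∣ A := by
      intro h2; have h := hA.dvd; omega
    rw [← Nat.factorization_def _ Nat.prime_two,
      factorization_two_conductorNorm_freyCurve_normalised hAB h0' hA hB, ← habs,
      padicValNat_natAbs_prod_eq h0' hA2 hB,
      refinedExp_add_one_eq_table (one_le_padicValNat_of_two_dvd hB0 hB)]
  · -- `Δ_E`
    rw [← habs]
    exact minimalDiscriminantNorm_freyCurve_normalised hAB h0' hA hB

/-- **`E_{−α, α+β} ~ E'`**: the presentation `y² = x(x + α)(x + α + β)` of `E_{α,β}` (translation by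
the `2`-torsion point `(α, 0)`, `translate_freyCurve`) is isogenous to `E' = (E_{α,β})'` — vKM: "`E`
admits the Weierstrass equation `y² = x'(x' − α)(x' + β)` … `E` is `ℚ`-isogenous to `E'`".
[cite: VonkanelMatschke2023, Lemma 10.5 (proof, arXiv §10.4 p. 59)] -/
theorem isIsogenous_freyCurve_translate_twoIsogenyCodomain (h0 : α * β * (α + β) ≠ 0) :
    (freyCurve (-α) (α + β)).IsIsogenous (freyCurve α β).twoIsogenyCodomain :=
  (isIsogenous_of_smul_eq' (translate_freyCurve α β)).trans'
    (isIsogenous_freyCurve_twoIsogenyCodomain h0)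

/-- **Lemma 10.5 when the even number is `β`** (`α ≡ −1 (mod 4)`): `E = E_{α,β}` itself is
normalised. [cite: VonkanelMatschke2023, Lemma 10.5 (proof, arXiv §10.4 p. 59)] -/
theorem lemma_10_5_of_even_snd (hαβ : IsCoprime α β) (h0 : α * β * (α + β) ≠ 0)
    (hα : α ≡ -1 [ZMOD 4]) (hβ : (2 : ℤ) ∣ β) (hrad : radical (α * β * (α + β)).natAbs ∣ primesProd S) :
    ∃ (W W' : WeierstrassCurve ℚ) (_ : W.IsElliptic) (_ : W'.IsElliptic),
      W.IsIsogenous W' ∧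
      W.conductorNorm ℤ ∣ 2 ^ 4 * primesProd S ∧
      (padicValNat 2 (W.conductorNorm ℤ) : ℤ) =
          refinedExp (padicValNat 2 (α * β * (α + β)).natAbs) + 1 ∧
      (W.minimalDiscriminantNorm ℤ = 2 ^ 4 * (α * β * (α + β)).natAbs ^ 2 ∨
        2 ^ 8 * W.minimalDiscriminantNorm ℤ = (α * β * (α + β)).natAbs ^ 2) ∧
      ∃ m : ℕ, m ≤ 3 ∧ 2 ^ (12 * m) * W'.minimalDiscriminantNorm ℤ =
        2 ^ 8 * (α * β).natAbs * (α + β).natAbs ^ 4 :=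
  lemma_10_5_of_presentation hαβ h0 hαβ h0 hα hβ rfl (isIsogenous_freyCurve_twoIsogenyCodomain h0) hrad

/-- **Lemma 10.5 when the even number is `α + β`** (`α ≡ 1 (mod 4)`): the normalised curve is the
presentation `E_{−α, α+β}`. [cite: VonkanelMatschke2023, Lemma 10.5 (proof, arXiv §10.4 p. 59)] -/
theorem lemma_10_5_of_even_sum (hαβ : IsCoprime α β) (h0 : α * β * (α + β) ≠ 0)
    (hα : α ≡ 1 [ZMOD 4]) (hγ : (2 : ℤ) ∣ α + β)
    (hrad : radical (α * β * (α + β)).natAbs ∣ primesProd S) :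
    ∃ (W W' : WeierstrassCurve ℚ) (_ : W.IsElliptic) (_ : W'.IsElliptic),
      W.IsIsogenous W' ∧
      W.conductorNorm ℤ ∣ 2 ^ 4 * primesProd S ∧
      (padicValNat 2 (W.conductorNorm ℤ) : ℤ) =
          refinedExp (padicValNat 2 (α * β * (α + β)).natAbs) + 1 ∧
      (W.minimalDiscriminantNorm ℤ = 2 ^ 4 * (α * β * (α + β)).natAbs ^ 2 ∨
        2 ^ 8 * W.minimalDiscriminantNorm ℤ = (α * β * (α + β)).natAbs ^ 2) ∧
      ∃ m : ℕ, m ≤ 3 ∧ 2 ^ (12 * m) * W'.minimalDiscriminantNorm ℤ =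
        2 ^ 8 * (α * β).natAbs * (α + β).natAbs ^ 4 := by
  have hcop : IsCoprime (-α) (α + β) := by
    have h := (hαβ.add_mul_left_right 1).neg_left
    rwa [mul_one, add_comm] at h
  have h0' : (-α) * (α + β) * (-α + (α + β)) ≠ 0 := by
    have : (-α) * (α + β) * (-α + (α + β)) = -(α * β * (α + β)) := by ring
    rw [this]; exact neg_ne_zero.mpr h0
  have hA : (-α) ≡ -1 [ZMOD 4] := hα.neg
  have habs : ((-α) * (α + β) * (-α + (α + β))).natAbs = (α * β * (α + β)).natAbs := by
    rw [show (-α) * (α + β) * (-α + (α + β)) = -(α * β * (α + β)) by ring, Int.natAbs_neg]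
  exact lemma_10_5_of_presentation hαβ h0 hcop h0' hA hγ habs
    (isIsogenous_freyCurve_translate_twoIsogenyCodomain h0) hrad

end Presentation

/-! ### 3. The discharge -/

/-- **von Känel–Matschke, Lemma 10.5 with (eq:refinedcondbound) — PROVED.** For every solution
`(a, b, c)` of (eq:abc) (`a + b = c`, `abc ≠ 0`, `gcd(a, b, c) = 1`, `rad(abc) ∣ N_S`) there are
`ℚ`-isogenous elliptic curves `E, E'` over `ℚ` with `N_E ∣ 2⁴N_S`, `ord₂(N_E) = 𝔢(ord₂(abc)) + 1`,
`Δ_E = 2⁴(abc)²` or `2⁸Δ_E = (abc)²`, and `2^{12m}Δ_{E'} = 2⁸|ab|c⁴` for some `m ≤ 3`. Proof as printed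
(§10.4): normalise to `E_{A,B}` with `A ≡ −1 (mod 4)`, `B` the even one of `±a, ±b, ±c`
(Frey–Hellegouarch curve; Diamond–Kramer for `N_E`, Bombieri–Gubler's minimal equations for
`Δ_E`), and take for `E'` Silverman's `2`-isogenous curve of the presentation with `γ = ±c`.
Discharges the named fact `vonKanelMatschke_lemma_10_5` (net debt −1).
[cite: VonkanelMatschke2023, Lemma 10.5 (arXiv §10.4, lem:psu2) with (eq:refinedcondbound)] -/
theorem vonKanelMatschke_lemma_10_5_holds : vonKanelMatschke_lemma_10_5 := by
  intro S hS a b c ha hb hc habc hgcd hrad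
  have hab : IsCoprime a b := isCoprime_of_gcd_gcd_eq_one habc hgcd
  have h0 : a * b * (a + b) ≠ 0 := by rw [habc]; exact mul_ne_zero (mul_ne_zero ha hb) hc
  -- the target, as a statement about `(α, β)` with `|αβ(α+β)| = |abc|`, `|αβ| = |ab|`, `|α+β| = |c|`
  have key : ∀ α β : ℤ, (α * β * (α + β)).natAbs = (a * b * c).natAbs →
      (α * β).natAbs = (a * b).natAbs → (α + β).natAbs = c.natAbs →
      (∃ (W W' : WeierstrassCurve ℚ) (_ : W.IsElliptic) (_ : W'.IsElliptic),
        W.IsIsogenous W' ∧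
        W.conductorNorm ℤ ∣ 2 ^ 4 * primesProd S ∧
        (padicValNat 2 (W.conductorNorm ℤ) : ℤ) =
            refinedExp (padicValNat 2 (α * β * (α + β)).natAbs) + 1 ∧
        (W.minimalDiscriminantNorm ℤ = 2 ^ 4 * (α * β * (α + β)).natAbs ^ 2 ∨
          2 ^ 8 * W.minimalDiscriminantNorm ℤ = (α * β * (α + β)).natAbs ^ 2) ∧
        ∃ m : ℕ, m ≤ 3 ∧ 2 ^ (12 * m) * W'.minimalDiscriminantNorm ℤ =
          2 ^ 8 * (α * β).natAbs * (α + β).natAbs ^ 4) →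
      ∃ (W W' : WeierstrassCurve ℚ) (_ : W.IsElliptic) (_ : W'.IsElliptic),
        W.IsIsogenous W' ∧
        W.conductorNorm ℤ ∣ 2 ^ 4 * primesProd S ∧
        (padicValNat 2 (W.conductorNorm ℤ) : ℤ) = refinedExp (padicValNat 2 (a * b * c).natAbs) + 1 ∧
        (W.minimalDiscriminantNorm ℤ = 2 ^ 4 * (a * b * c).natAbs ^ 2 ∨
          2 ^ 8 * W.minimalDiscriminantNorm ℤ = (a * b * c).natAbs ^ 2) ∧
        ∃ m : ℕ, m ≤ 3 ∧ 2 ^ (12 * m) * W'.minimalDiscriminantNorm ℤ =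
          2 ^ 8 * (a * b).natAbs * c.natAbs ^ 4 := by
    intro α β h1 h2 h3 h
    rw [h1, h2, h3] at h
    exact h
  -- `|αβ(α+β)|, |αβ|, |α+β|` for the four candidate pairs `(±a, ±b)`, `(±b, ±a)`
  have e1 : (a * b * (a + b)).natAbs = (a * b * c).natAbs := by rw [habc]
  have e1n : ((-a) * (-b) * (-a + -b)).natAbs = (a * b * c).natAbs := by
    rw [show (-a) * (-b) * (-a + -b) = -(a * b * (a + b)) by ring, Int.natAbs_neg, habc]
  have e1s : (b * a * (b + a)).natAbs = (a * b * c).natAbs := by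
    rw [show b * a * (b + a) = a * b * (a + b) by ring, habc]
  have e1sn : ((-b) * (-a) * (-b + -a)).natAbs = (a * b * c).natAbs := by
    rw [show (-b) * (-a) * (-b + -a) = -(a * b * (a + b)) by ring, Int.natAbs_neg, habc]
  have e2n : ((-a) * (-b)).natAbs = (a * b).natAbs := by rw [neg_mul_neg]
  have e2s : (b * a).natAbs = (a * b).natAbs := by rw [mul_comm]
  have e2sn : ((-b) * (-a)).natAbs = (a * b).natAbs := by rw [neg_mul_neg, mul_comm]
  have e3 : (a + b).natAbs = c.natAbs := by rw [habc]
  have e3n : (-a + -b).natAbs = c.natAbs := by rw [← neg_add, Int.natAbs_neg, habc]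
  have e3s : (b + a).natAbs = c.natAbs := by rw [add_comm, habc]
  have e3sn : (-b + -a).natAbs = c.natAbs := by rw [← neg_add, Int.natAbs_neg, add_comm, habc]
  -- radical hypothesis and non-vanishing for each candidate pair
  have hrad' : ∀ α β : ℤ, (α * β * (α + β)).natAbs = (a * b * c).natAbs →
      radical (α * β * (α + β)).natAbs ∣ primesProd S := fun α β h ↦ by rw [h]; exact hrad
  have h0' : ∀ α β : ℤ, (α * β * (α + β)).natAbs = (a * b * c).natAbs → α * β * (α + β) ≠ 0 :=
    fun α β h ↦ by rw [← Int.natAbs_ne_zero, h, Int.natAbs_ne_zero, ← habc]; exact h0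
  have hnot := not_two_dvd_and_two_dvd_of_isCoprime hab
  by_cases hb2 : (2 : ℤ) ∣ b
  · -- `b` even, `a` odd: `E = E_{±a, ±b}`
    have ha2 : ¬ (2 : ℤ) ∣ a := fun h ↦ hnot ⟨h, hb2⟩
    by_cases ha4 : a ≡ -1 [ZMOD 4]
    · exact key a b e1 rfl e3
        (lemma_10_5_of_even_snd hab (h0' a b e1) ha4 hb2 (hrad' a b e1))
    · have ha4' : (-a) ≡ -1 [ZMOD 4] := by unfold Int.ModEq at ha4 ⊢; omega
      exact key (-a) (-b) e1n e2n e3n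
        (lemma_10_5_of_even_snd hab.neg_neg (h0' _ _ e1n) ha4' (dvd_neg.mpr hb2) (hrad' _ _ e1n))
  · by_cases ha2 : (2 : ℤ) ∣ a
    · -- `a` even, `b` odd: `E = E_{±b, ±a}`
      by_cases hb4 : b ≡ -1 [ZMOD 4]
      · exact key b a e1s e2s e3s
          (lemma_10_5_of_even_snd hab.symm (h0' b a e1s) hb4 ha2 (hrad' b a e1s))
      · have hb4' : (-b) ≡ -1 [ZMOD 4] := by unfold Int.ModEq at hb4 ⊢; omega
        exact key (-b) (-a) e1sn e2sn e3sn
          (lemma_10_5_of_even_snd hab.symm.neg_neg (h0' _ _ e1sn) hb4' (dvd_neg.mpr ha2)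
            (hrad' _ _ e1sn))
    · -- `a`, `b` odd, `c` even: `E = E_{∓a, ±c}`, a translate of `E_{±a, ±b}`
      have hc2 : (2 : ℤ) ∣ a + b := by omega
      by_cases ha4 : a ≡ 1 [ZMOD 4]
      · exact key a b e1 rfl e3
          (lemma_10_5_of_even_sum hab (h0' a b e1) ha4 hc2 (hrad' a b e1))
      · have ha4' : (-a) ≡ 1 [ZMOD 4] := by unfold Int.ModEq at ha4 ⊢; omega
        exact key (-a) (-b) e1n e2n e3n
          (lemma_10_5_of_even_sum hab.neg_neg (h0' _ _ e1n) ha4' (by rw [← neg_add]; exact dvd_neg.mpr hc2)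
            (hrad' _ _ e1n))

end Literature.NumberTheory.EllipticCurves.ModularForms

end
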